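import Literature.Topology.FourManifolds.FishtailDiscInj
import Literature.Topology.FourManifolds.StraightLineIsotopyExtension
import HarnessLib

/-!
# The tube about Gompf's disc is embedded

Infrastructure for the explicit fishtail neighbourhood (R. Gompf, *More Cappell–Shaneson spheres
are standard*, Algebr. Geom. Topol. 10 (2010), proof of Thm 2.1 and Lemma 2.2; the named fact
`Literature.Topology.FourManifolds.gompf2010_framedTwist`). The tubular-neighbourhood argument for
Gompf's embedded disc `D`:

* `FP.tubRad_pos` — the reference tube is injective on `{‖ζ‖ ≤ R} × {a² + b² < δ²}` for some
  `δ > 0` (compactness: it is an injective local homeomorphism along the disc,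
  `exists_isOpen_injOn_of_isCompact`), so the injectivity radius `tubRad` is positive and
  `FP.injOn_tubeD_ref` holds on `{‖ζ‖ ≤ R} × {a² + b² < tubRad²}`;
* `FP.injOn_tubeD` — the actual tube (leg radius `ρ_b ≤ tubRad / 2`, un-shearing `μ_L`) is
  injective on `{‖ζ‖ < L_c + 3/100} × AdmP`: below `s₇` it *is* the reference tube, and on the
  leg it is the reference tube after the monotone reparametrisation
  `posL r ↦ posL r + 2 c (ρ_b - |w|) μ_L (posL r)` of the position.

Everything is proved; no named facts.

## References

* R. E. Gompf, *More Cappell–Shaneson spheres are standard*, Algebr. Geom. Topol. 10 (2010)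
  1665–1681, proof of Thm 2.1 and Lemma 2.2. [GompfAGT2010]
-/

noncomputable section

open scoped Real Topology ContDiff Manifold
open Set Filter Complex Metric

namespace Literature.Topology.FourManifolds

local notation "𝔼 " n:arg => EuclideanSpace ℝ (Fin n)

namespace FP

variable {ε : ℝ} (hε : 0 < ε) (hε2 : ε ≤ 1 / 2)

/-! ### The injectivity radius of the reference tube is positive -/

/-- The tube domain of radius `δ` over the disc of radius `R`. [folklore] -/
def tubDom (δ : ℝ) : Set (ℂ × ℝ × ℝ) := {q | ‖q.1‖ ≤ Rdisc ε ∧ q.2.1 ^ 2 + q.2.2 ^ 2 < δ ^ 2}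

/-- `tubDom (ε`. [folklore] -/
theorem tubDom_mono {δ δ' : ℝ} (hδ : 0 ≤ δ) (h : δ ≤ δ') : tubDom (ε := ε) δ ⊆ tubDom (ε := ε) δ' :=
  fun _ hq ↦ ⟨hq.1, lt_of_lt_of_le hq.2 (pow_le_pow_left₀ hδ h 2)⟩

/-- `δ ∈ tubGood ε hε hε2 ↔ 0 ≤ δ ∧ δ ≤ 1 ∧ InjOn (fishTref ε hε hε2).tubeD (tubDom (ε`. [folklore] -/
theorem mem_tubGood_iff {δ : ℝ} : δ ∈ tubGood ε hε hε2 ↔ 0 ≤ δ ∧ δ ≤ 1 ∧ InjOn (fishTref ε hε hε2).tubeD (tubDom (ε := ε) δ) :=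
  Iff.rfl

/-- `(0 : ℝ) ∈ tubGood ε hε hε2`. [folklore] -/
theorem zero_mem_tubGood : (0 : ℝ) ∈ tubGood ε hε hε2 := by
  refine ⟨le_rfl, zero_le_one, fun q hq ↦ ?_⟩
  have : q.2.1 ^ 2 + q.2.2 ^ 2 < 0 := by simpa using hq.2
  nlinarith

/-- `BddAbove (tubGood ε hε hε2)`. [folklore] -/
theorem bddAbove_tubGood : BddAbove (tubGood ε hε hε2) := ⟨1, fun _ h ↦ h.2.1⟩

/-- `tubRad ε hε hε2 ≤ 1`. [folklore] -/
theorem tubRad_le_one : tubRad ε hε hε2 ≤ 1 := csSup_le ⟨0, zero_mem_tubGood hε hε2⟩ fun _ h ↦ h.2.1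

include hε2 in
/-- **A local diffeomorphism is locally injective**: near every point of the disc the reference
tube is injective. [folklore] -/
theorem exists_nhds_injOn_ref {q : ℂ × ℝ × ℝ} (hq : q.2 ∈ DiscP ε hε hε2) (hr : ‖q.1‖ < Rdisc ε + 1) :
    ∃ U ∈ 𝓝 q, InjOn (fishTref ε hε hε2).tubeD U := by
  have h := isLocalDiffeomorphAt_tubeD_ref hε hε2 hq hr
  refine ⟨h.localInverse.target, h.localInverse.open_target.mem_nhds h.localInverse_mem_target, fun a ha b hb hab ↦ ?_⟩
  rw [← h.localInverse_left_inv ha, ← h.localInverse_left_inv hb]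
  exact congrArg h.localInverse hab

include hε2 in
/-- **The reference tube is injective on a tube about the disc**: some `δ ∈ (0, 1]` is good. [folklore] -/
theorem exists_pos_mem_tubGood : ∃ δ, 0 < δ ∧ δ ∈ tubGood ε hε hε2 := by
  set T := fishTref ε hε hε2 with hT
  set K : Set (ℂ × ℝ × ℝ) := closedBall (0 : ℂ) (Rdisc ε) ×ˢ {((0 : ℝ), (0 : ℝ))} with hK
  have hKc : IsCompact K := (isCompact_closedBall _ _).prod isCompact_singleton
  have hρ := rhoB_pos hε hε2
  have h0 : ((0 : ℝ), (0 : ℝ)) ∈ DiscP ε hε hε2 := by show (0:ℝ) ^ 2 + (0:ℝ) ^ 2 < rhoB ε hε hε2 ^ 2; nlinarith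
  have hmemK : ∀ q ∈ K, ‖q.1‖ ≤ Rdisc ε ∧ q.2 = (0, 0) := by
    rintro ⟨ζ, w⟩ ⟨hζ, hw⟩
    rw [mem_closedBall, dist_zero_right] at hζ
    exact ⟨hζ, hw⟩
  have hcont : ∀ q ∈ K, ContinuousAt T.tubeD q := by
    intro q hq
    obtain ⟨h1, h2⟩ := hmemK q hq
    exact (isLocalDiffeomorphAt_tubeD_ref hε hε2 (by rw [h2]; exact h0) (by linarith)).contMDiffAt.continuousAt
  have hinj : InjOn T.tubeD K := by
    intro q hq q' hq' h
    obtain ⟨h1, h2⟩ := hmemK q hq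
    obtain ⟨h1', h2'⟩ := hmemK q' hq'
    have hd : discRef hε hε2 q.1 = discRef hε hε2 q'.1 := by
      rw [discRef, discRef]
      have e1 : (q.1, (0:ℝ), (0:ℝ)) = q := by rw [← h2]
      have e2 : (q'.1, (0:ℝ), (0:ℝ)) = q' := by rw [← h2']
      rw [e1, e2]; exact h
    have := injOn_discRef hε hε2 (by rw [mem_closedBall, dist_zero_right]; exact h1)
      (by rw [mem_closedBall, dist_zero_right]; exact h1') hd
    exact Prod.ext this (by rw [h2, h2'])
  have hloc : ∀ q ∈ K, ∃ U ∈ 𝓝 q, InjOn T.tubeD U := by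
    intro q hq
    obtain ⟨h1, h2⟩ := hmemK q hq
    exact exists_nhds_injOn_ref hε hε2 (by rw [h2]; exact h0) (by linarith)
  obtain ⟨V, hVo, hKV, hV⟩ := exists_isOpen_injOn_of_isCompact hKc hcont hinj hloc
  obtain ⟨δ, hδ, hδV⟩ := hKc.exists_cthickening_subset_open hVo hKV
  refine ⟨min δ 1, lt_min hδ one_pos, (le_min hδ.le zero_le_one), min_le_right _ _, hV.mono ?_⟩
  -- the tube domain of radius `min δ 1` lies in the `δ`-thickening of `K`
  intro q hq
  refine hδV (Metric.mem_cthickening_of_dist_le q (q.1, (0:ℝ), (0:ℝ)) δ K ⟨?_, rfl⟩ ?_)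
  · rw [mem_closedBall, dist_zero_right]; exact hq.1
  · have hlt : q.2.1 ^ 2 + q.2.2 ^ 2 < δ ^ 2 := lt_of_lt_of_le hq.2 (pow_le_pow_left₀ (le_min hδ.le zero_le_one) (min_le_left _ _) 2)
    rw [Prod.dist_eq, dist_self, Prod.dist_eq, Real.dist_eq, Real.dist_eq, sub_zero, sub_zero]
    have ha : |q.2.1| ≤ δ := abs_le_of_sq_le_sq (by nlinarith [sq_nonneg q.2.2]) hδ.le
    have hb : |q.2.2| ≤ δ := abs_le_of_sq_le_sq (by nlinarith [sq_nonneg q.2.1]) hδ.le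
    exact max_le (by positivity) (max_le ha hb)

include hε2 in
/-- **The injectivity radius of the reference tube is positive.** [folklore] -/
theorem tubRad_pos : 0 < tubRad ε hε hε2 := by
  obtain ⟨δ, hδ, hmem⟩ := exists_pos_mem_tubGood hε hε2
  exact lt_of_lt_of_le hδ (le_csSup (bddAbove_tubGood hε hε2) hmem)

include hε2 in
/-- **The reference tube is injective on the tube of radius `tubRad` about the disc.** [folklore] -/
theorem injOn_tubeD_ref : InjOn (fishTref ε hε hε2).tubeD (tubDom (ε := ε) (tubRad ε hε hε2)) := by
  intro q hq q' hq' h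
  -- both offsets lie in a good tube of slightly smaller radius
  set m := max (Real.sqrt (q.2.1 ^ 2 + q.2.2 ^ 2)) (Real.sqrt (q'.2.1 ^ 2 + q'.2.2 ^ 2)) with hm
  have hpos := tubRad_pos hε hε2
  have hm0 : 0 ≤ m := le_max_of_le_left (Real.sqrt_nonneg _)
  have hmlt : m < tubRad ε hε hε2 := by
    refine max_lt ?_ ?_
    · rw [Real.sqrt_lt' hpos]; exact hq.2
    · rw [Real.sqrt_lt' hpos]; exact hq'.2
  obtain ⟨δ, hδmem, hmδ⟩ := (lt_csSup_iff (bddAbove_tubGood hε hε2) ⟨0, zero_mem_tubGood hε hε2⟩).1 hmlt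
  have hsub : ∀ {p : ℂ × ℝ × ℝ}, ‖p.1‖ ≤ Rdisc ε → Real.sqrt (p.2.1 ^ 2 + p.2.2 ^ 2) ≤ m → p ∈ tubDom (ε := ε) δ := by
    intro p hp1 hp2
    refine ⟨hp1, ?_⟩
    have : Real.sqrt (p.2.1 ^ 2 + p.2.2 ^ 2) < δ := lt_of_le_of_lt hp2 hmδ
    rw [Real.sqrt_lt' (lt_of_le_of_lt hm0 hmδ)] at this; exact this
  exact hδmem.2.2 (hsub hq.1 (le_max_left _ _)) (hsub hq'.1 (le_max_right _ _)) h

include hε2 in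
/-- `2 ρ_b ≤ tubRad`. [folklore] -/
theorem two_rhoB_le_tubRad : 2 * rhoB ε hε hε2 ≤ tubRad ε hε hε2 := by
  have := rhoB_le_tub hε hε2
  rw [tubRad'_eq ε hε hε2 (tubRad_pos hε hε2)] at this; linarith

/-! ### The actual tube is the reference tube after a reparametrisation of the leg -/

section Actual

/-- The windows below the leg do not see `(c, ρ_b, μ)`. [folklore] -/
theorem winS_eq : (fishT ε hε hε2).winS = (fishTref ε hε hε2).winS := rfl
/-- `(fishT ε hε hε2).winA = (fishTref ε hε hε2).winA`. [folklore] -/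
theorem winA_eq : (fishT ε hε hε2).winA = (fishTref ε hε hε2).winA := rfl
/-- `(fishT ε hε hε2).winN = (fishTref ε hε hε2).winN`. [folklore] -/
theorem winN_eq : (fishT ε hε hε2).winN = (fishTref ε hε hε2).winN := rfl
/-- `(fishT ε hε hε2).winU5 = (fishTref ε hε hε2).winU5`. [folklore] -/
theorem winU5_eq : (fishT ε hε hε2).winU5 = (fishTref ε hε hε2).winU5 := rfl
/-- `(fishT ε hε hε2).winU4 = (fishTref ε hε hε2).winU4`. [folklore] -/
theorem winU4_eq : (fishT ε hε hε2).winU4 = (fishTref ε hε hε2).winU4 := rfl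
/-- `(fishT ε hε hε2).winU3 = (fishTref ε hε hε2).winU3`. [folklore] -/
theorem winU3_eq : (fishT ε hε hε2).winU3 = (fishTref ε hε hε2).winU3 := rfl
/-- `(fishT ε hε hε2).winU2 = (fishTref ε hε hε2).winU2`. [folklore] -/
theorem winU2_eq : (fishT ε hε hε2).winU2 = (fishTref ε hε hε2).winU2 := rfl
/-- `(fishT ε hε hε2).posL = (fishTref ε hε hε2).posL`. [folklore] -/
theorem posL_eq_ref : (fishT ε hε hε2).posL = (fishTref ε hε hε2).posL := by
  rw [fishT, fishTref_eq, posL_eq, posL_eq]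
  congr 1
  funext r
  rw [rL_eq, rL_eq, cL_mul_rhoB', one_mul]

include hε2 in
/-- **Below `s₇` the actual tube is the reference tube.** [folklore] -/
theorem tubeD_eq_ref_of_lt {q : ℂ × ℝ × ℝ} (h : ‖q.1‖ < s7 ε) : (fishT ε hε hε2).tubeD q = (fishTref ε hε hε2).tubeD q := by
  set T := fishT ε hε hε2
  set T' := fishTref ε hε hε2
  show glueBy (fun q ↦ ‖q.1‖) (3 / 4) T.winS (glueBy (fun q ↦ ‖q.1‖) (s2 ε) T.winA (glueBy (fun q ↦ ‖q.1‖) (s3 ε) T.winN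
    (glueBy (fun q ↦ ‖q.1‖) (s4 ε) T.winU5 (glueBy (fun q ↦ ‖q.1‖) (s5 ε) T.winU4 (glueBy (fun q ↦ ‖q.1‖) (s6 ε) T.winU3
      (glueBy (fun q ↦ ‖q.1‖) (s7 ε) T.winU2 T.winU1)))))) q =
    glueBy (fun q ↦ ‖q.1‖) (3 / 4) T'.winS (glueBy (fun q ↦ ‖q.1‖) (s2 ε) T'.winA (glueBy (fun q ↦ ‖q.1‖) (s3 ε) T'.winN
    (glueBy (fun q ↦ ‖q.1‖) (s4 ε) T'.winU5 (glueBy (fun q ↦ ‖q.1‖) (s5 ε) T'.winU4 (glueBy (fun q ↦ ‖q.1‖) (s6 ε) T'.winU3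
      (glueBy (fun q ↦ ‖q.1‖) (s7 ε) T'.winU2 T'.winU1)))))) q
  simp only [glueBy, h, if_true]
  rfl

/-- The leg shift `2 c (ρ_b - |w|) μ_L (posL r)`. [folklore] -/
def legShift (r : ℝ) (w : ℝ × ℝ) : ℝ :=
  2 * cL ε hε hε2 * (rhoB ε hε hε2 - Real.sqrt (w.1 ^ 2 + w.2 ^ 2)) * muL ε ((fishTref ε hε hε2).posL r)

include hε2 in
/-- The shift is in `[0, 2E₁]` on the annulus of offsets. [folklore] -/
theorem legShift_mem {w : ℝ × ℝ} (hw : w ∈ AdmP ε hε hε2) (r : ℝ) : 0 ≤ legShift hε hε2 r w ∧ legShift hε hε2 r w ≤ 2 * E1 := by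
  obtain ⟨hs, -, -, -, hlo⟩ := adm_bounds hε2 hw
  have hc := cL_pos ε hε hε2
  have hμ := stdBlend_mem (s7 ε + 1 / 25) (s7 ε + 7 / 100) ((fishTref ε hε hε2).posL r)
  rw [legShift, muL]
  have h1 : 0 ≤ cL ε hε hε2 * (rhoB ε hε hε2 - Real.sqrt (w.1 ^ 2 + w.2 ^ 2)) := mul_nonneg hc.le (by linarith)
  have h2 : cL ε hε hε2 * (rhoB ε hε hε2 - Real.sqrt (w.1 ^ 2 + w.2 ^ 2)) ≤ E1 := by
    have : rhoB ε hε hε2 - Real.sqrt (w.1 ^ 2 + w.2 ^ 2) < E1 / cL ε hε hε2 := by linarith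
    have := mul_le_mul_of_nonneg_left this.le hc.le
    rwa [mul_div_cancel₀ _ hc.ne'] at this
  constructor <;> nlinarith [hμ.1, hμ.2]

include hε2 in
/-- **The leg window of the actual tube is the leg window of the reference tube at the shifted
position**: if `posL r' = posL r + shift` then `T.winU1 (ζ, w) = T_ref.winU1 (ζ', w)` for
`ζ' = r' e^{i arg ζ}`. [folklore] -/
theorem winU1_eq_ref {ζ : ℂ} {w : ℝ × ℝ} {r' : ℝ} (hr' : 0 < r')
    (h : (fishTref ε hε hε2).posL r' = (fishTref ε hε hε2).posL ‖ζ‖ + legShift hε hε2 ‖ζ‖ w) :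
    (fishT ε hε hε2).winU1 (ζ, w) = (fishTref ε hε hε2).winU1 ((r' : ℂ) * exp (arg ζ * I), w) := by
  have hn : ‖(r' : ℂ) * exp (arg ζ * I)‖ = r' := by
    rw [norm_mul, Complex.norm_exp_ofReal_mul_I, mul_one, Complex.norm_real, Real.norm_eq_abs, abs_of_pos hr']
  have ha : arg ((r' : ℂ) * exp (arg ζ * I)) = arg ζ := by
    rw [Complex.arg_real_mul _ hr', Complex.arg_exp_mul_I, toIocMod_eq_self]
    exact ⟨by linarith [Complex.neg_pi_lt_arg ζ], by linarith [Complex.arg_le_pi ζ]⟩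
  rw [TubeDData.winU1, TubeDData.winU1, radialForm_apply, radialForm_apply, hn, ha, posL_eq_ref]
  show physX _ _ (legTubeMap (muL ε) (cL ε hε hε2) (rhoB ε hε hε2) (nj ε) cY ((fishTref ε hε hε2).posL ‖ζ‖, arg ζ, w)) =
    physX _ _ (legTubeMap (fun _ ↦ 0) 1 (Lc ε) (nj ε) cY ((fishTref ε hε hε2).posL r', arg ζ, w))
  congr 1
  simp only [legTubeMap, legT, h, legShift, mul_zero, add_zero, one_mul, cL_mul_rhoB']
  ring_nf

include hε2 in
/-- **Existence of the shifted position**: every value `≥ posL s₇` below `s₇ + 2` is attained by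
`posL` on `[s₇, s₇ + 2]`. [folklore] -/
theorem exists_posL_eq {v : ℝ} (h1 : (fishTref ε hε hε2).posL (s7 ε) ≤ v) (h2 : v ≤ s7 ε + 2) :
    ∃ r', s7 ε ≤ r' ∧ r' ≤ s7 ε + 2 ∧ (fishTref ε hε hε2).posL r' = v := by
  have hcρ : (1:ℝ) * Lc ε = Lc ε := one_mul _
  have hcont : ContinuousOn (fishTref ε hε hε2).posL (Icc (s7 ε) (s7 ε + 2)) := fun r hr ↦
    (deriv_posL_pos hε hε2 (c := 1) (ρb := Lc ε) (μ := fun _ ↦ 0) hcρ (by linarith [hr.1])).2.continuousAt.continuousWithinAt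
  have htop : (fishTref ε hε hε2).posL (s7 ε + 2) = s7 ε + 2 := by
    rw [fishTref_eq, posL_eq, blendFun, stdBlend_of_ge (by unfold a8 b8; linarith [eta_lt hε hε2, eta_pos ε hε]) (by unfold b8; linarith)]
    ring
  obtain ⟨r', hr', hv⟩ := intermediate_value_Icc (by linarith) hcont ⟨h1, by rw [htop]; exact h2⟩
  exact ⟨r', hr'.1, hr'.2, hv⟩

include hε2 in
/-- `g(r) = posL r + k μ_L (posL r)` (`k ≥ 0`) is strictly increasing beyond `s₇ - 3/100`. [folklore] -/
theorem strictMonoOn_posL_shift {k : ℝ} (hk : 0 ≤ k) :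
    StrictMonoOn (fun r ↦ (fishTref ε hε hε2).posL r + k * muL ε ((fishTref ε hε hε2).posL r)) (Ioi (s7 ε - 3 / 100)) := by
  intro r hr r' hr' hlt
  have h1 := strictMonoOn_posL hε hε2 hr hr' hlt
  have h2 : muL ε ((fishTref ε hε hε2).posL r) ≤ muL ε ((fishTref ε hε hε2).posL r') := by
    rw [muL, muL, stdBlend, stdBlend]
    exact Real.smoothTransition.monotone (div_le_div_of_nonneg_right (by linarith) (by norm_num))
  simp only
  nlinarith [mul_le_mul_of_nonneg_left h2 hk]

include hε2 in
/-- **The actual tube is injective on `{‖ζ‖ < L_c + 3/100} × AdmP`.** [folklore] -/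
theorem injOn_tubeD : InjOn (fishT ε hε hε2).tubeD {q : ℂ × ℝ × ℝ | ‖q.1‖ < Lc ε + 3 / 100 ∧ q.2 ∈ AdmP ε hε hε2} := by
  set T := fishT ε hε hε2 with hT
  set T' := fishTref ε hε hε2 with hT'
  have hη := eta_pos ε hε; have hη' := eta_lt hε hε2
  have htan := tan_beta7_ge (ε := ε); have htan' := (tan_beta7_bounds ε).2
  have hE := E1_le
  have hρ := rhoB_pos hε hε2
  have h2ρ := two_rhoB_le_tubRad hε hε2
  have hRd : Rdisc ε = s7 ε + 1 := rfl
  have hLc : Lc ε = s7 ε + 22 / 100 + Real.tan (beta7 ε) := rfl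
  -- the reduction map: `(ζ, w) ↦ (ζ', w)` with `T.tubeD (ζ, w) = T'.tubeD (ζ', w)`, `‖ζ'‖ ≤ R`, and `‖ζ'‖ = ‖ζ‖` below `s₇`
  have red : ∀ q : ℂ × ℝ × ℝ, ‖q.1‖ < Lc ε + 3 / 100 → q.2 ∈ AdmP ε hε hε2 →
      ∃ ζ' : ℂ, T.tubeD q = T'.tubeD (ζ', q.2) ∧ ‖ζ'‖ ≤ Rdisc ε ∧ arg ζ' = arg q.1 ∧
        (‖q.1‖ < s7 ε → ζ' = q.1) ∧
        (s7 ε ≤ ‖q.1‖ → s7 ε ≤ ‖ζ'‖ ∧ T'.posL ‖ζ'‖ = T'.posL ‖q.1‖ + legShift hε hε2 ‖q.1‖ q.2) := by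
    rintro ⟨ζ, w⟩ hr hw
    simp only at hr hw ⊢
    by_cases h7 : ‖ζ‖ < s7 ε
    · exact ⟨ζ, tubeD_eq_ref_of_lt hε hε2 h7, by linarith, rfl, fun _ ↦ rfl, fun h ↦ absurd h7 (not_lt.2 h)⟩
    · rw [not_lt] at h7
      obtain ⟨hs0, hs1⟩ := legShift_mem hε hε2 hw ‖ζ‖
      -- the value to hit
      have hmono := strictMonoOn_posL hε hε2
      have hle : T'.posL (s7 ε) ≤ T'.posL ‖ζ‖ := hmono.monotoneOn (by simp) (by show s7 ε - 3 / 100 < ‖ζ‖; linarith) h7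
      have hup : T'.posL ‖ζ‖ ≤ ‖ζ‖ + 1 / 10 := by
        rw [hT', fishTref_eq, posL_eq]
        by_cases hb : b8 ε ≤ ‖ζ‖
        · rw [blendFun_of_one (stdBlend_of_ge (by unfold a8 b8; linarith) hb)]; linarith
        · rw [not_le] at hb
          have h3 : |‖ζ‖ - s7 ε| ≤ 3 / 100 := by unfold b8 at hb; rw [abs_le]; constructor <;> linarith
          have h4 := abs_rL_sub_le hε hε2 (c := 1) (ρb := Lc ε) (μ := fun _ ↦ (0:ℝ)) (one_mul _) h3
          have h5 : (fishTgen ε hε hε2 1 (Lc ε) fun _ ↦ (0:ℝ)).rL (angleDown (rone ε) ‖ζ‖) ≤ ‖ζ‖ + 1 / 10 := by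
            have := (abs_le.1 h4).2
            have : |‖ζ‖ - s7 ε| ≤ 3 / 100 := h3
            unfold b8 at hb
            nlinarith [abs_nonneg (‖ζ‖ - s7 ε), (abs_le.1 h3).1]
          rw [blendFun]
          have hχ := stdBlend_mem (a8 ε) (b8 ε) ‖ζ‖
          nlinarith [hχ.1, hχ.2]
      have hv2 : T'.posL ‖ζ‖ + legShift hε hε2 ‖ζ‖ w ≤ s7 ε + 2 := by linarith
      obtain ⟨r', hr'1, hr'2, hr'v⟩ := exists_posL_eq hε hε2 (by linarith) hv2
      have hr'0 : 0 < r' := by linarith [s7_gt ε hε]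
      refine ⟨(r' : ℂ) * exp (arg ζ * I), ?_, ?_, ?_, fun h ↦ absurd h (not_lt.2 h7), fun _ ↦ ?_⟩
      · -- `T.tubeD = T.winU1` here and `T'.tubeD (ζ', w) = T'.winU1`
        have hn : ‖(r' : ℂ) * exp (arg ζ * I)‖ = r' := by
          rw [norm_mul, Complex.norm_exp_ofReal_mul_I, mul_one, Complex.norm_real, Real.norm_eq_abs, abs_of_pos hr'0]
        have e1 : T.tubeD (ζ, w) = T.winU1 (ζ, w) := by
          obtain ⟨w12, w23, w34, w45, w56, w67, -⟩ := windows hε hε2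
          show glueBy (fun q ↦ ‖q.1‖) (3 / 4) T.winS (glueBy (fun q ↦ ‖q.1‖) (s2 ε) T.winA (glueBy (fun q ↦ ‖q.1‖) (s3 ε) T.winN
            (glueBy (fun q ↦ ‖q.1‖) (s4 ε) T.winU5 (glueBy (fun q ↦ ‖q.1‖) (s5 ε) T.winU4 (glueBy (fun q ↦ ‖q.1‖) (s6 ε) T.winU3
            (glueBy (fun q ↦ ‖q.1‖) (s7 ε) T.winU2 T.winU1)))))) (ζ, w) = _
          simp only [glueBy]
          rw [if_neg (by show ¬‖ζ‖ < 3 / 4; linarith), if_neg (by show ¬‖ζ‖ < s2 ε; linarith), if_neg (by show ¬‖ζ‖ < s3 ε; linarith),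
            if_neg (by show ¬‖ζ‖ < s4 ε; linarith), if_neg (by show ¬‖ζ‖ < s5 ε; linarith), if_neg (by show ¬‖ζ‖ < s6 ε; linarith),
            if_neg (by show ¬‖ζ‖ < s7 ε; linarith)]
        have e2 : T'.tubeD ((r' : ℂ) * exp (arg ζ * I), w) = T'.winU1 ((r' : ℂ) * exp (arg ζ * I), w) := by
          obtain ⟨w12, w23, w34, w45, w56, w67, -⟩ := windows hε hε2
          show glueBy (fun q ↦ ‖q.1‖) (3 / 4) T'.winS (glueBy (fun q ↦ ‖q.1‖) (s2 ε) T'.winA (glueBy (fun q ↦ ‖q.1‖) (s3 ε) T'.winN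
            (glueBy (fun q ↦ ‖q.1‖) (s4 ε) T'.winU5 (glueBy (fun q ↦ ‖q.1‖) (s5 ε) T'.winU4 (glueBy (fun q ↦ ‖q.1‖) (s6 ε) T'.winU3
            (glueBy (fun q ↦ ‖q.1‖) (s7 ε) T'.winU2 T'.winU1)))))) ((r' : ℂ) * exp (arg ζ * I), w) = _
          simp only [glueBy, hn]
          rw [if_neg (by linarith), if_neg (by linarith), if_neg (by linarith), if_neg (by linarith), if_neg (by linarith),
            if_neg (by linarith), if_neg (by linarith)]
        rw [e1, e2]
        exact winU1_eq_ref hε hε2 hr'0 hr'v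
      · rw [norm_mul, Complex.norm_exp_ofReal_mul_I, mul_one, Complex.norm_real, Real.norm_eq_abs, abs_of_pos hr'0, hRd]
        -- `posL r' = posL r + shift ≤ r + 1/10 + 2E₁ < s₇ + …`; and `posL r' = r'` once `r' ≥ b₈`
        by_contra hcon
        rw [not_le] at hcon
        have hid : T'.posL r' = r' := by
          rw [hT', fishTref_eq, posL_eq, blendFun, stdBlend_of_ge (by unfold a8 b8; linarith) (by unfold b8; linarith)]; ring
        rw [hid] at hr'v
        linarith
      · rw [Complex.arg_real_mul _ hr'0, Complex.arg_exp_mul_I, toIocMod_eq_self]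
        exact ⟨by linarith [Complex.neg_pi_lt_arg ζ], by linarith [Complex.arg_le_pi ζ]⟩
      · rw [norm_mul, Complex.norm_exp_ofReal_mul_I, mul_one, Complex.norm_real, Real.norm_eq_abs, abs_of_pos hr'0]
        exact ⟨hr'1, hr'v⟩
  -- injectivity
  rintro ⟨ζ₁, w₁⟩ ⟨h1r, h1w⟩ ⟨ζ₂, w₂⟩ ⟨h2r, h2w⟩ heq
  simp only at h1r h1w h2r h2w
  obtain ⟨ζ₁', e1, n1, a1, lo1, hi1⟩ := red (ζ₁, w₁) h1r h1w
  obtain ⟨ζ₂', e2, n2, a2, lo2, hi2⟩ := red (ζ₂, w₂) h2r h2w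
  simp only at e1 n1 a1 lo1 hi1 e2 n2 a2 lo2 hi2
  have hd1 : (ζ₁', w₁) ∈ tubDom (ε := ε) (tubRad ε hε hε2) := ⟨n1, by have := h1w.2; nlinarith⟩
  have hd2 : (ζ₂', w₂) ∈ tubDom (ε := ε) (tubRad ε hε hε2) := ⟨n2, by have := h2w.2; nlinarith⟩
  have key := injOn_tubeD_ref hε hε2 hd1 hd2 (by rw [← e1, ← e2]; exact heq)
  obtain ⟨hζ', hw⟩ := Prod.ext_iff.1 key
  simp only at hζ' hw
  subst hw
  refine Prod.ext ?_ rfl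
  simp only
  -- recover `ζ₁ = ζ₂` from `ζ₁' = ζ₂'`
  have harg : arg ζ₁ = arg ζ₂ := by rw [← a1, ← a2, hζ']
  suffices hnorm : ‖ζ₁‖ = ‖ζ₂‖ by
    rw [← norm_mul_exp_arg_mul_I ζ₁, ← norm_mul_exp_arg_mul_I ζ₂, hnorm, harg]
  by_cases h71 : ‖ζ₁‖ < s7 ε <;> by_cases h72 : ‖ζ₂‖ < s7 ε
  · rw [← lo1 h71, ← lo2 h72, hζ']
  · exfalso
    obtain ⟨hs, -⟩ := hi2 (not_lt.1 h72)
    rw [← hζ', lo1 h71] at hs; linarith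
  · exfalso
    obtain ⟨hs, -⟩ := hi1 (not_lt.1 h71)
    rw [hζ', lo2 h72] at hs; linarith
  · obtain ⟨-, hp1⟩ := hi1 (not_lt.1 h71)
    obtain ⟨-, hp2⟩ := hi2 (not_lt.1 h72)
    rw [hζ'] at hp1
    rw [hp1] at hp2
    -- `posL r₁ + k μ(posL r₁) = posL r₂ + k μ(posL r₂)` with the same `k`
    have hk : 0 ≤ 2 * cL ε hε hε2 * (rhoB ε hε hε2 - Real.sqrt (w₁.1 ^ 2 + w₁.2 ^ 2)) := by
      obtain ⟨hs, -⟩ := adm_bounds hε2 h1w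
      exact mul_nonneg (mul_nonneg (by norm_num) (cL_pos ε hε hε2).le) (by linarith)
    have hinj := (strictMonoOn_posL_shift hε hε2 hk).injOn (show s7 ε - 3 / 100 < ‖ζ₁‖ by linarith [not_lt.1 h71])
      (show s7 ε - 3 / 100 < ‖ζ₂‖ by linarith [not_lt.1 h72])
    refine hinj ?_
    simp only [legShift] at hp2 ⊢
    linarith

end Actual

end FP

end Literature.Topology.FourManifolds
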